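import Mathlib.Analysis.Fourier.ZMod
import Literature.NumberTheory.ModularForms.CohenEisensteinSeriesModularity
import Summits.BirchSwinnertonDyer.BirchSwinnertonDyer.Theorems.PrintCFramBottomClassIndexLawFiveLeFlipRungTwoOddCut
import HarnessLib

/-!
# Crux `PrintCFram.BottomClassIndexLawFiveLe` (stmt-BirchSwinnertonDyer-20372), line `eisenstein-resource-bdp-line` (registry v29 `stub_flipRungs.2`):
# THE 2-ADIC FLIPPED-CUSP RUNG, modular assembly piece (M1b) — THE ODD-CONDITION CUT `G` OF COHEN'S `H_k` AND `g = G|U_4`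
# (cell `bsd-print-cfram`, width seat `bsd-line-cfram-p1-w7` g9; THEOREMS ONLY, `--supports` 20372 `--as helper`; BSD is not proved by any of this)

HONEST FRAMING. Nothing here is a statement about BSD, elliptic curves or Bernoulli numbers; no registered stub is closed. Sequel of (M1)
`…FlipRungTwoOddCut` (square-class translate averages stay in `M_{k/2}` at genuinely half-integral weight). Here the weights are made
explicit (`b = Q⁻¹·𝓕S` for a square-class stable `S : ℤ/Q → ℂ`) and the construction is SPECIALISED to the index set of the 2-adic rung:
AWAY₂ `= {i : m/4 ∣ i, J(−(i/(m/4)) | q′) = τ q′ (odd primes q′ ∣ m), 3 ∤ i/(m/4)}` — the odd conditions of seat w6 g10's (JMLTwo⁶)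
(HOME/STATUS 2026-08-29T10:40:47Z; its coefficient function `a = 𝟙_{AWAY₂}·H(k,·)`). AWAY₂ is `Q₀ = 3(m/4)²`-periodic and stable under
`i ↦ v² i` for `v` prime to `Q₀`, so:

* §1 `sum_fourierWeight_mul_stdAddChar` (Fourier inversion on `ℤ/Q`), `fourierWeight_sqClass` (stability passes to `Q⁻¹·𝓕S`, Mathlib
  `ZMod.dft_comp_unitMul`);
* §2 **`sqClassCut_mem_halfIntModularForms`** / `qCoeffs_sqClassCut` / `sqClassCut_smul`: the cut of `f ∈ M_{k/2}(N, χ)` along `S` lies in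
  `M_{k/2}(N Q², χ)` with `qCoeffs = S(n)·a(n)` and transforms with `autFactor k N χ` on `Γ₀(N Q²)`;
* §3 `awayTwo_add_period_iff`, `awayTwo_mod_iff`, `awayTwo_sq_mul_iff`, `awayTwoIndicator_sqClass` — the elementary number theory of AWAY₂;
* §4 **`exists_awayTwoCut_cohen`**: from NF-A (Cohen 1975 Thm 3.1, hypothesis) a member `G ∈ halfIntModularForms (2k+1) (4·Q₀²) 1` with
  `qCoeffs G i = 𝟙_{AWAY₂}(i)·H(k,i)`; **`heckeFun_two_mem_qCoeffs_smul`**: `g = heckeFun K χ 2 G = G|U_4` is in the same space, has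
  `qCoeffs g n = qCoeffs G (4n)` and `g(γz) = autFactor K N χ γ z·g z` on `Γ₀(N)` — exactly the `hg` input of P1
  `…FlipRungTwoFlipIdentity.apply_translate_flippedCusp` / `hasSum_oddPart_flippedCusp` (take `N = 4Q₀²`, `M′ = Q₀²`, so `γ_j ∈ Γ₀(8M′) ≤ Γ₀(N)`).

No definitions, no named facts, no `sorry`. beyond-print theorem: NO (Shimura 1973 §1 / Cohen 1975 Thm 3.1 bookkeeping).
References: [Shimura1973HalfIntegral] §1, Prop. 1.5, Thm. 1.7; [Cohen1975] Thm. 3.1 (NF-A, currency only); crux notes w7g8-T6 §5b–§5c.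
-/

set_option autoImplicit false
-- summit-side namespace `Summit.BirchSwinnertonDyer.BirchSwinnertonDyer.…` (single-conjunct summit, D-0017 layout)
set_option linter.dupNamespace false

noncomputable section

open UpperHalfPlane hiding I
open Complex CongruenceSubgroup
open scoped MatrixGroups NumberTheorySymbols Real
open Literature.NumberTheory.EllipticCurves.ModularForms

namespace Summit.BirchSwinnertonDyer.BirchSwinnertonDyer.Theorems.PrintCFram.FlipRung

/-! ## §1 Fourier weights of a square-class stable function on `ℤ/Q` -/

/-- **Fourier inversion** for the weights `b = Q⁻¹·𝓕S`: `Σ_t b(t) ψ_Q(t n) = S(n)` (Mathlib `ZMod.invDFT_apply`). [folklore] -/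
theorem sum_fourierWeight_mul_stdAddChar {Q : ℕ} [NeZero Q] (S : ZMod Q → ℂ) (n : ZMod Q) :
    ∑ t : ZMod Q, ((Q : ℂ)⁻¹ • ZMod.dft S) t * ZMod.stdAddChar (t * n) = S n := by
  have hQ : (Q : ℂ) ≠ 0 := Nat.cast_ne_zero.mpr (NeZero.ne Q)
  have h1 := ZMod.invDFT_apply (ZMod.dft S) n
  rw [LinearEquiv.symm_apply_apply] at h1
  rw [h1, Finset.smul_sum]
  refine Finset.sum_congr rfl fun t _ ↦ ?_
  simp only [Pi.smul_apply, smul_eq_mul]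
  ring

/-- **Square-class stability passes to the Fourier weights**: if `S(u² m) = S(m)` for every unit `u` of `ℤ/Q`, then
`b = Q⁻¹·𝓕S` satisfies `b(u² t) = b(t)` (Mathlib `ZMod.dft_comp_unitMul` with the unit `u⁻²`). [folklore] -/
theorem fourierWeight_sqClass {Q : ℕ} [NeZero Q] (S : ZMod Q → ℂ) (hS : ∀ u m : ZMod Q, IsUnit u → S (u ^ 2 * m) = S m)
    (u t : ZMod Q) (hu : IsUnit u) : ((Q : ℂ)⁻¹ • ZMod.dft S) (u ^ 2 * t) = ((Q : ℂ)⁻¹ • ZMod.dft S) t := by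
  simp only [Pi.smul_apply]
  congr 1
  set w : (ZMod Q)ˣ := (hu.unit⁻¹) ^ 2 with hw
  have hSw : (fun j ↦ S (w.val * j)) = S := by
    funext j
    rw [hw]
    push_cast
    exact hS _ j (hu.unit⁻¹).isUnit
  have hw' : (w⁻¹).val = u ^ 2 := by
    rw [hw, inv_pow, inv_inv]
    push_cast
    rw [IsUnit.unit_spec]
  have h := ZMod.dft_comp_unitMul S w t
  rw [hSw, hw'] at h
  exact h.symm

/-! ## §2 The cut of `f ∈ M_{k/2}(N, χ)` along a square-class stable `Q`-periodic index function -/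

/-- **SQUARE-CLASS CUTS PRESERVE `M_{k/2}`**: for `f ∈ M_{k/2}(N, χ)` (`4 ∣ N`), `Q ≥ 1` and `S : ℤ/Q → ℂ` with `S(u²m) = S(m)` for all units
`u`, the cut `z ↦ Σ_t (Q⁻¹𝓕S)(t) f(z + t/Q)` lies in `M_{k/2}(N Q², χ)` ((M1) `sqClassAverage_mem_halfIntModularForms` + §1). [cite: Shimura1973HalfIntegral, §1, Prop. 1.5] -/
theorem sqClassCut_mem_halfIntModularForms {k N : ℕ} {χ : DirichletCharacter ℂ N} (hN : 4 ∣ N) {Q : ℕ} [NeZero Q]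
    {f : ℍ → ℂ} (hf : f ∈ halfIntModularForms k N χ) (S : ZMod Q → ℂ) (hS : ∀ u m : ZMod Q, IsUnit u → S (u ^ 2 * m) = S m) :
    (fun z : ℍ ↦ ∑ t : ZMod Q, ((Q : ℂ)⁻¹ • ZMod.dft S) t * f (((((t.val : ℝ) / (Q : ℝ) : ℝ)) +ᵥ z : ℍ))) ∈
      halfIntModularForms k (N * Q ^ 2) (DirichletCharacter.changeLevel (dvd_mul_right N (Q ^ 2)) χ) :=
  sqClassAverage_mem_halfIntModularForms hN hf _ (fun u t hu ↦ fourierWeight_sqClass S hS u t hu)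

/-- **… with `q`-expansion `S(n)·a(n)`**: `qCoeffs (cut) n = S(n mod Q) · qCoeffs f n`. [cite: Shimura1973HalfIntegral, §1, Prop. 1.5] -/
theorem qCoeffs_sqClassCut {k N : ℕ} {χ : DirichletCharacter ℂ N} {Q : ℕ} [NeZero Q]
    {f : ℍ → ℂ} (hf : f ∈ halfIntModularForms k N χ) (S : ZMod Q → ℂ) (n : ℕ) :
    qCoeffs (fun z : ℍ ↦ ∑ t : ZMod Q, ((Q : ℂ)⁻¹ • ZMod.dft S) t * f (((((t.val : ℝ) / (Q : ℝ) : ℝ)) +ᵥ z : ℍ))) n =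
      S (n : ZMod Q) * qCoeffs f n := by
  rw [qCoeffs_translateAverage hf, sum_fourierWeight_mul_stdAddChar]

/-- The automorphy of the cut in the `hg`-shape consumed by P1 (`…FlipRungTwoFlipIdentity.apply_translate_flippedCusp`):
`cut(γ•z) = autFactor k N χ γ z · cut(z)` for every `γ ∈ Γ₀(N Q²)` (note: the factor at level `N`, `= autFactor k (NQ²) χ↑ γ z`). [folklore] -/
theorem sqClassCut_smul {k N : ℕ} {χ : DirichletCharacter ℂ N} (hN : 4 ∣ N) {Q : ℕ} [NeZero Q]
    {f : ℍ → ℂ} (hf : f ∈ halfIntModularForms k N χ) (S : ZMod Q → ℂ) (hS : ∀ u m : ZMod Q, IsUnit u → S (u ^ 2 * m) = S m)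
    {γ : SL(2, ℤ)} (hγ : γ ∈ Gamma0 (N * Q ^ 2)) (z : ℍ) :
    (∑ t : ZMod Q, ((Q : ℂ)⁻¹ • ZMod.dft S) t * f (((((t.val : ℝ) / (Q : ℝ) : ℝ)) +ᵥ γ • z : ℍ))) =
      autFactor k N χ γ z * ∑ t : ZMod Q, ((Q : ℂ)⁻¹ • ZMod.dft S) t * f (((((t.val : ℝ) / (Q : ℝ) : ℝ)) +ᵥ z : ℍ)) := by
  have hγ' : ((N * Q ^ 2 : ℕ) : ℤ) ∣ γ 1 0 := by
    rw [Gamma0_mem, ZMod.intCast_zmod_eq_zero_iff_dvd] at hγ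
    exact hγ
  exact sqClassAverage_smul hN (fun γ hγ z ↦ apply_smul_eq_of_mem hN hf hγ z) _
    (fun u t hu ↦ fourierWeight_sqClass S hS u t hu) hγ' z

/-! ## §3 The AWAY₂ index set of the 2-adic rung is `3(m/4)²`-periodic and stable under unit squares -/

/-- **Periodicity of AWAY₂.** The odd conditions of the 2-adic rung — `m/4 ∣ i`, `J(−(i/(m/4)) | q′) = τ q′` for the odd primes `q′ ∣ m`, and
`3 ∤ i/(m/4)` (`4 ∣ m`) — are invariant under `i ↦ i + 3(m/4)²` (seat w6 g10's `exists_period_awayTwo_odd` states the same period; proved here to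
keep the import closure at `HalfIntegralWeightFormsProofs`). [folklore] -/
theorem awayTwo_add_period_iff (m : ℕ) (τ : ℕ → ℤ) (hm : 4 ∣ m) (hm1 : 0 < m / 4) (i : ℕ) :
    (m / 4 ∣ i + 3 * (m / 4) ^ 2 ∧
        (∀ q' : ℕ, q'.Prime → q' ∣ m → q' ≠ 2 → jacobiSym (-(((i + 3 * (m / 4) ^ 2) / (m / 4) : ℕ) : ℤ)) q' = τ q') ∧
        ¬ 3 ∣ (i + 3 * (m / 4) ^ 2) / (m / 4)) ↔
      (m / 4 ∣ i ∧ (∀ q' : ℕ, q'.Prime → q' ∣ m → q' ≠ 2 → jacobiSym (-((i / (m / 4) : ℕ) : ℤ)) q' = τ q') ∧ ¬ 3 ∣ i / (m / 4)) := by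
  set m₁ : ℕ := m / 4 with hm₁
  have hm4 : m = 4 * m₁ := by rw [hm₁]; exact (Nat.mul_div_cancel' hm).symm
  have hdiv : (i + 3 * m₁ ^ 2) / m₁ = i / m₁ + 3 * m₁ := by
    rw [show i + 3 * m₁ ^ 2 = i + m₁ * (3 * m₁) by ring, Nat.add_mul_div_left _ _ hm1]
  have h1 : m₁ ∣ i + 3 * m₁ ^ 2 ↔ m₁ ∣ i := Nat.dvd_add_left ⟨3 * m₁, by ring⟩
  have h3 : (¬ 3 ∣ i / m₁ + 3 * m₁) ↔ ¬ 3 ∣ i / m₁ := by rw [Nat.dvd_add_left (dvd_mul_right 3 m₁)]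
  have hq : ∀ q' : ℕ, q'.Prime → q' ∣ m → q' ≠ 2 →
      jacobiSym (-(((i / m₁ + 3 * m₁ : ℕ)) : ℤ)) q' = jacobiSym (-((i / m₁ : ℕ) : ℤ)) q' := by
    intro q' hq' hq'm hq'2
    have hq'm₁ : q' ∣ m₁ := by
      rw [hm4] at hq'm
      rcases (Nat.Prime.dvd_mul hq').mp hq'm with h | h
      · exfalso
        have : q' ∣ 2 ^ 2 := by simpa using h
        exact hq'2 ((Nat.prime_dvd_prime_iff_eq hq' Nat.prime_two).mp (hq'.dvd_of_dvd_pow this))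
      · exact h
    obtain ⟨r, hr⟩ := hq'm₁
    apply jacobiSym.mod_left'
    rw [show (-(((i / m₁ + 3 * m₁ : ℕ)) : ℤ)) = -((i / m₁ : ℕ) : ℤ) + (q' : ℤ) * (-(3 * r : ℤ)) by rw [hr]; push_cast; ring,
      Int.add_mul_emod_self_left]
  rw [hdiv, h1, h3]
  constructor
  · rintro ⟨hA, hB, hC⟩
    exact ⟨hA, fun q' hq' hq'm hq'2 ↦ by rw [← hq q' hq' hq'm hq'2]; exact hB q' hq' hq'm hq'2, hC⟩
  · rintro ⟨hA, hB, hC⟩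
    exact ⟨hA, fun q' hq' hq'm hq'2 ↦ by rw [hq q' hq' hq'm hq'2]; exact hB q' hq' hq'm hq'2, hC⟩

/-- Periodicity iterated: AWAY₂ depends on `i mod 3(m/4)²` only. [folklore] -/
theorem awayTwo_mod_iff (m : ℕ) (τ : ℕ → ℤ) (hm : 4 ∣ m) (hm1 : 0 < m / 4) (i : ℕ) :
    (m / 4 ∣ i % (3 * (m / 4) ^ 2) ∧
        (∀ q' : ℕ, q'.Prime → q' ∣ m → q' ≠ 2 → jacobiSym (-(((i % (3 * (m / 4) ^ 2)) / (m / 4) : ℕ) : ℤ)) q' = τ q') ∧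
        ¬ 3 ∣ (i % (3 * (m / 4) ^ 2)) / (m / 4)) ↔
      (m / 4 ∣ i ∧ (∀ q' : ℕ, q'.Prime → q' ∣ m → q' ≠ 2 → jacobiSym (-((i / (m / 4) : ℕ) : ℤ)) q' = τ q') ∧ ¬ 3 ∣ i / (m / 4)) := by
  have key : ∀ c n : ℕ, ((m / 4 ∣ n + 3 * (m / 4) ^ 2 * c ∧
        (∀ q' : ℕ, q'.Prime → q' ∣ m → q' ≠ 2 → jacobiSym (-(((n + 3 * (m / 4) ^ 2 * c) / (m / 4) : ℕ) : ℤ)) q' = τ q') ∧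
        ¬ 3 ∣ (n + 3 * (m / 4) ^ 2 * c) / (m / 4)) ↔
      (m / 4 ∣ n ∧ (∀ q' : ℕ, q'.Prime → q' ∣ m → q' ≠ 2 → jacobiSym (-((n / (m / 4) : ℕ) : ℤ)) q' = τ q') ∧ ¬ 3 ∣ n / (m / 4))) := by
    intro c
    induction c with
    | zero => intro n; simp
    | succ c ih =>
      intro n
      rw [show n + 3 * (m / 4) ^ 2 * (c + 1) = (n + 3 * (m / 4) ^ 2 * c) + 3 * (m / 4) ^ 2 by ring,
        awayTwo_add_period_iff m τ hm hm1, ih]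
  have h := key (i / (3 * (m / 4) ^ 2)) (i % (3 * (m / 4) ^ 2))
  rw [Nat.mod_add_div] at h
  exact h.symm

/-- **Stability of AWAY₂ under unit squares**: for `v` prime to `3(m/4)²`, `i ↦ v² i` preserves the three odd conditions
(`m/4 ∣ v²i ⟺ m/4 ∣ i`; `J(−v²n | q′) = J(−n | q′)` as `q′ ∤ v`; `3 ∣ v²n ⟺ 3 ∣ n`). [folklore] -/
theorem awayTwo_sq_mul_iff (m : ℕ) (τ : ℕ → ℤ) (hm : 4 ∣ m) {v : ℕ} (hv : v.Coprime (3 * (m / 4) ^ 2)) (i : ℕ) :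
    (m / 4 ∣ v ^ 2 * i ∧
        (∀ q' : ℕ, q'.Prime → q' ∣ m → q' ≠ 2 → jacobiSym (-(((v ^ 2 * i) / (m / 4) : ℕ) : ℤ)) q' = τ q') ∧
        ¬ 3 ∣ (v ^ 2 * i) / (m / 4)) ↔
      (m / 4 ∣ i ∧ (∀ q' : ℕ, q'.Prime → q' ∣ m → q' ≠ 2 → jacobiSym (-((i / (m / 4) : ℕ) : ℤ)) q' = τ q') ∧ ¬ 3 ∣ i / (m / 4)) := by
  set m₁ : ℕ := m / 4 with hm₁
  have hm4 : m = 4 * m₁ := by rw [hm₁]; exact (Nat.mul_div_cancel' hm).symm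
  have hvm₁ : v.Coprime m₁ := Nat.Coprime.coprime_dvd_right (Dvd.intro_left (3 * m₁) (by ring)) hv
  have hv3 : v.Coprime 3 := Nat.Coprime.coprime_dvd_right (Dvd.intro (m₁ ^ 2) (by ring)) hv
  have h1 : m₁ ∣ v ^ 2 * i ↔ m₁ ∣ i := Nat.Coprime.dvd_mul_left (Nat.Coprime.pow_right 2 hvm₁.symm)
  by_cases hmi : m₁ ∣ i
  · have hdiv : v ^ 2 * i / m₁ = v ^ 2 * (i / m₁) := Nat.mul_div_assoc _ hmi
    have h3 : (¬ 3 ∣ v ^ 2 * (i / m₁)) ↔ ¬ 3 ∣ i / m₁ := by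
      rw [Nat.Coprime.dvd_mul_left (Nat.Coprime.pow_right 2 hv3.symm)]
    have hq : ∀ q' : ℕ, q'.Prime → q' ∣ m → q' ≠ 2 →
        jacobiSym (-(((v ^ 2 * (i / m₁) : ℕ)) : ℤ)) q' = jacobiSym (-((i / m₁ : ℕ) : ℤ)) q' := by
      intro q' hq' hq'm hq'2
      have hq'm₁ : q' ∣ m₁ := by
        rw [hm4] at hq'm
        rcases (Nat.Prime.dvd_mul hq').mp hq'm with h | h
        · exfalso
          have : q' ∣ 2 ^ 2 := by simpa using h
          exact hq'2 ((Nat.prime_dvd_prime_iff_eq hq' Nat.prime_two).mp (hq'.dvd_of_dvd_pow this))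
        · exact h
      have hvq : ((v : ℤ)).gcd q' = 1 := by
        rw [Int.gcd_natCast_natCast]
        exact Nat.Coprime.coprime_dvd_right hq'm₁ hvm₁
      rw [show (-(((v ^ 2 * (i / m₁) : ℕ)) : ℤ)) = (v : ℤ) ^ 2 * (-((i / m₁ : ℕ) : ℤ)) by push_cast; ring,
        jacobiSym.mul_left, jacobiSym.sq_one' hvq, one_mul]
    rw [h1, hdiv, h3]
    constructor
    · rintro ⟨hA, hB, hC⟩
      exact ⟨hA, fun q' hq' hq'm hq'2 ↦ by rw [← hq q' hq' hq'm hq'2]; exact hB q' hq' hq'm hq'2, hC⟩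
    · rintro ⟨hA, hB, hC⟩
      exact ⟨hA, fun q' hq' hq'm hq'2 ↦ by rw [hq q' hq' hq'm hq'2]; exact hB q' hq' hq'm hq'2, hC⟩
  · constructor
    · rintro ⟨hA, -, -⟩; exact absurd (h1.mp hA) hmi
    · rintro ⟨hA, -, -⟩; exact absurd hA hmi

open scoped Classical in
/-- The indicator of AWAY₂ on `ℤ/3(m/4)²` (read on representatives) is stable under unit squares. [folklore] -/
theorem awayTwoIndicator_sqClass (m : ℕ) (τ : ℕ → ℤ) (hm : 4 ∣ m) (hm1 : 0 < m / 4) [NeZero (3 * (m / 4) ^ 2)]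
    (u x : ZMod (3 * (m / 4) ^ 2)) (hu : IsUnit u) :
    (if (m / 4 ∣ (u ^ 2 * x).val ∧
          (∀ q' : ℕ, q'.Prime → q' ∣ m → q' ≠ 2 → jacobiSym (-(((u ^ 2 * x).val / (m / 4) : ℕ) : ℤ)) q' = τ q') ∧
          ¬ 3 ∣ (u ^ 2 * x).val / (m / 4)) then (1 : ℂ) else 0) =
      (if (m / 4 ∣ x.val ∧ (∀ q' : ℕ, q'.Prime → q' ∣ m → q' ≠ 2 → jacobiSym (-((x.val / (m / 4) : ℕ) : ℤ)) q' = τ q') ∧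
          ¬ 3 ∣ x.val / (m / 4)) then (1 : ℂ) else 0) := by
  obtain ⟨w, rfl⟩ := hu
  have hval : ((w : ZMod (3 * (m / 4) ^ 2)) ^ 2 * x).val = ((w : ZMod (3 * (m / 4) ^ 2)).val ^ 2 * x.val) % (3 * (m / 4) ^ 2) := by
    rw [show (w : ZMod (3 * (m / 4) ^ 2)) ^ 2 * x = (w : ZMod (3 * (m / 4) ^ 2)) * ((w : ZMod (3 * (m / 4) ^ 2)) * x) by ring,
      ZMod.val_mul, ZMod.val_mul, Nat.mul_mod_mod,
      show (w : ZMod (3 * (m / 4) ^ 2)).val ^ 2 * x.val = (w : ZMod (3 * (m / 4) ^ 2)).val * ((w : ZMod (3 * (m / 4) ^ 2)).val * x.val) by ring]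
  have hcop := ZMod.val_coe_unit_coprime w
  simp only [hval, awayTwo_mod_iff m τ hm hm1, awayTwo_sq_mul_iff m τ hm hcop]

/-! ## §4 The odd-condition cut `G` of Cohen's `H_k` and `g = G|U_4` -/

open scoped Classical in
/-- **THE AWAY₂ CUT OF `H_k` IS A FORM OF WEIGHT `k + 1/2` ON `Γ₀(4·Q₀²)`, `Q₀ = 3(m/4)²`, WITH TRIVIAL CHARACTER** (from NF-A = Cohen 1975
Thm 3.1 and §2–§3): there is `G ∈ M_{(2k+1)/2}(4Q₀², 1)` whose `q`-expansion is `𝟙_{AWAY₂}(i)·H(k, i)` — the coefficient function `a` of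
(JMLTwo⁶) (seat w6 g10, HOME/STATUS 2026-08-29T10:40:47Z). CONDITIONAL on NF-A (hypothesis). [cite: Cohen1975, Thm. 3.1] -/
theorem exists_awayTwoCut_cohen (hA : Literature.NumberTheory.ModularForms.Cohen1975.thm31_cohenSeries_mem_halfIntModularForms)
    {k : ℕ} (hk : 2 ≤ k) (m : ℕ) (τ : ℕ → ℤ) (hm : 4 ∣ m) (hm1 : 0 < m / 4) :
    ∃ G : ℍ → ℂ, G ∈ halfIntModularForms (2 * k + 1) (4 * (3 * (m / 4) ^ 2) ^ 2)
        (1 : DirichletCharacter ℂ (4 * (3 * (m / 4) ^ 2) ^ 2)) ∧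
      ∀ i : ℕ, qCoeffs G i =
        if (m / 4 ∣ i ∧ (∀ q' : ℕ, q'.Prime → q' ∣ m → q' ≠ 2 → jacobiSym (-((i / (m / 4) : ℕ) : ℤ)) q' = τ q') ∧
            ¬ 3 ∣ i / (m / 4)) then ((Literature.NumberTheory.ModularForms.CohenEisenstein.cohenH k i : ℚ) : ℂ) else 0 := by
  classical
  obtain ⟨H, hH, hHq⟩ := hA k hk
  set Q₀ : ℕ := 3 * (m / 4) ^ 2 with hQ₀
  haveI : NeZero Q₀ := ⟨by rw [hQ₀]; positivity⟩
  set S : ZMod Q₀ → ℂ := fun x ↦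
    if (m / 4 ∣ x.val ∧ (∀ q' : ℕ, q'.Prime → q' ∣ m → q' ≠ 2 → jacobiSym (-((x.val / (m / 4) : ℕ) : ℤ)) q' = τ q') ∧
        ¬ 3 ∣ x.val / (m / 4)) then (1 : ℂ) else 0 with hS_def
  have hS : ∀ u x : ZMod Q₀, IsUnit u → S (u ^ 2 * x) = S x := fun u x hu ↦ by
    simp only [hS_def]
    exact awayTwoIndicator_sqClass m τ hm hm1 u x hu
  refine ⟨fun z : ℍ ↦ ∑ t : ZMod Q₀, ((Q₀ : ℂ)⁻¹ • ZMod.dft S) t * H (((((t.val : ℝ) / (Q₀ : ℝ) : ℝ)) +ᵥ z : ℍ)), ?_, fun i ↦ ?_⟩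
  · have h := sqClassCut_mem_halfIntModularForms (by norm_num : 4 ∣ 4) hH S hS
    rwa [DirichletCharacter.changeLevel_one] at h
  · rw [qCoeffs_sqClassCut hH S i, hHq i]
    have hmod := awayTwo_mod_iff m τ hm hm1 i
    rw [← hQ₀] at hmod
    simp only [hS_def, ZMod.val_natCast, hmod]
    split_ifs <;> simp

/-- **`g = G|U_4`** for `G ∈ M_{K/2}(N, χ)` with `K` odd, `4 ∣ N`: `g := heckeFun K χ 2 G` (the tree's `T(2²)`, which IS `U_4` because `χ(2) = 0`)
lies in `M_{K/2}(N, χ)`, has `qCoeffs g n = qCoeffs G (4n)`, and satisfies `g(γz) = autFactor K N χ γ z · g z` on `Γ₀(N)` — the `hg` input of P1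
`…FlipRungTwoFlipIdentity.apply_translate_flippedCusp`. [cite: Shimura1973HalfIntegral, Thm. 1.7, Prop. 1.5] -/
theorem heckeFun_two_mem_qCoeffs_smul {K N : ℕ} {χ : DirichletCharacter ℂ N} (hN : 4 ∣ N) (hK : Odd K) {G : ℍ → ℂ}
    (hG : G ∈ halfIntModularForms K N χ) :
    @heckeFun K N χ 2 ⟨Nat.prime_two⟩ G ∈ halfIntModularForms K N χ ∧
      (∀ n : ℕ, qCoeffs (@heckeFun K N χ 2 ⟨Nat.prime_two⟩ G) n = qCoeffs G (4 * n)) ∧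
      ∀ γ ∈ Gamma0 N, ∀ z : ℍ,
        @heckeFun K N χ 2 ⟨Nat.prime_two⟩ G (γ • z) = autFactor K N χ γ z * @heckeFun K N χ 2 ⟨Nat.prime_two⟩ G z := by
  haveI : Fact (Nat.Prime 2) := ⟨Nat.prime_two⟩
  refine ⟨heckeFun_mem hN hK hG, fun n ↦ ?_, fun γ hγ z ↦ heckeFun_smul hN hK hG hγ z⟩
  rw [qCoeffs_heckeFun hN hK hG, heckeTSq_apply_of_dvd K χ (by norm_num : (2 : ℕ) ≠ 1) (dvd_trans ⟨2, rfl⟩ hN)]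
  norm_num

end Summit.BirchSwinnertonDyer.BirchSwinnertonDyer.Theorems.PrintCFram.FlipRung

end
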